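import Summits.ResolutionOfSingularities.ResolutionOfSingularities.Theorems.FrobeniusClosingSteerHighPointStepDecompositionTwo
import Summits.ResolutionOfSingularities.ResolutionOfSingularities.Theorems.FrobeniusClosingSteerRadicandLocalization
import Mathlib.RingTheory.Ideal.KrullsHeightTheorem
import Mathlib.Algebra.CharP.Subring
import Mathlib.Algebra.CharP.Lemmas
import HarnessLib

/-!
# Crux `Steer` (stmt-ResolutionOfSingularities-16345), chain W4.1, §σ2.26: **the cleaning before an ISOLATED next member is OPTIMAL**
# (the (B1) / optimality conjunct of `CleanedOrderMonotone`; Theses-free, def-free)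

OURS (campaign `res-hironaka`, rung L ★L-G4, slot W4.1; seat res-D-pv-011; support brick for res-type-096's (B2)
`CleanedOrderMonotone` (res-L0-w41-strat-2 §σ2.26 / MEMO rev 12 §6⁗ (B1), res-L0-w41-plan-1 RULINGS 66/80); replaces the role of no
printed item and is NOT a statement of the manuscript under review [claim: Hironaka2017, status: under-review]; AI-produced, weaker
than expert review).

THE STATEMENT (`cleaning_optimal_of_isolated_next`). One cleaning-and-stripping step `S₀ ≤ S₁ ⊆ L` (`char L = p`) of a K♭-shaped chain:
`𝔪_{S₀}·S₁ = (x₀)` with `x₀ ∈ 𝔪_{S₁} ∖ 𝔪_{S₁}²`, `S₁` regular local of dimension `c ≥ 3`, radicand law `f₁ · x₀^(p·e₀) = f₀ − g₀^p`,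
and at stage 1 the torsor `T^p = f₁` has multiplicity `p` (`∃ h, f₁ − h^p ∈ 𝔪_{S₁}^p`) and an ISOLATED singularity (every non-maximal prime
of `S₁[T]/(T^p − f₁)` localises to a regular ring — the skeleton's `HasIsolatedSingularity (RadicandRing S₁ p f₁)` UNFOLDED, as in K(c)).
THEN the stage-0 cleaning was optimal: `f₀ − h^p ∉ 𝔪_{S₀}^(p·e₀ + 1)` for every `h ∈ S₀`.

PROOF. If `f₀ − h^p ∈ 𝔪₀^(p e₀ + 1) ⊆ x₀^(p e₀ + 1)·S₁` then `(h − g₀)^p = h^p − g₀^p = x₀^(p e₀)·(f₁ − x₀ u)`, so `x₀^{e₀} ∣ h − g₀` in the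
integrally closed domain `S₁` (`IsIntegrallyClosed.pow_dvd_pow_iff`; regular ⇒ normal, Matsumura 19.4) and `f₁ = x₀·u + q^p` with
`u, q ∈ S₁`. (i) `u` a unit: the multiplicity clause gives `x₀ u + (q − h₁)^p ∈ 𝔪₁^p`; if `q − h₁ ∈ 𝔪₁` this puts `x₀ ∈ 𝔪₁^p ⊆ 𝔪₁²`,
else the left side is a unit — both absurd. (ii) `u ∈ 𝔪₁`: a minimal prime `Q ⊇ (x₀, u)` has height `≤ 2 < c` (Krull), so `Q ≠ 𝔪₁`, and
`f₁ − q^p = x₀ u ∈ Q²` makes the torsor SINGULAR at `Q` (`AutoPermissible.not_isRegularLocalRing_atPrime_of_sub_pow_mem_sq`, Matsumura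
14.2), i.e. at a NON-maximal prime of `S₁[T]/(T^p − f₁)` over `Q` (`RadicandLocalization.exists_prime_under_eq_of_ne_maximalIdeal`,
`…isRegularLocalRing_localization_atPrime_iff_of_under_eq`) — contradicting isolatedness. The guard `c ≥ 3` is used exactly once
(«height ≤ 2 ⇒ non-maximal»); at `c = 2` the statement fails (strat-2: `f₀ = v³ + u⁷`).

Binders `x₀ ∈ 𝔪_{S₁}`, `x₀ ∉ 𝔪_{S₁}²`: §3 `excParam_mem_and_not_mem_sq` derives them from `IsQuadraticTransform S₀ S₁` + the span clause
(Chevalley valuation ring dominating `S₁`; the exceptional hypersurface of the chart is regular), and §4 `cleaning_optimal_of_quadraticTransform`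
states the conjunct over the K♭ step binders of `CleanedOrderMonotone` VERBATIM.
[cite: Matsumura1987, Thm. 14.2, Thm. 19.4] [folklore]
-/

noncomputable section

-- `Summit.<S>.<S>.…` duplicates the summit name by design (single-problem summit).
set_option linter.dupNamespace false

open Polynomial IsLocalRing

namespace Summit.ResolutionOfSingularities.ResolutionOfSingularities.Theorems.SwitchingDichotomy.CleaningOptimal

open Literature.AlgebraicGeometry.Resolution

/-! ## §1 Two generic lemmas -/

/-- **Krull for two elements**: in a Noetherian local ring whose maximal ideal has height `> 2`, two non-units lie in a common prime
ideal `Q ≠ 𝔪` (a minimal prime over `(a, b)` has height `≤ 2`, Krull's Hauptidealsatz generalised). [cite: Matsumura1987, Thm. 13.5] -/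
theorem exists_prime_ne_maximalIdeal_of_two_lt_height {S : Type*} [CommRing S] [IsNoetherianRing S] [IsLocalRing S]
    {a b : S} (ha : a ∈ maximalIdeal S) (hb : b ∈ maximalIdeal S) (hdim : (2 : ℕ∞) < (maximalIdeal S).height) :
    ∃ Q : Ideal S, Q.IsPrime ∧ a ∈ Q ∧ b ∈ Q ∧ Q ≠ maximalIdeal S := by
  classical
  set I : Ideal S := Ideal.span {a, b} with hI
  have hIm : I ≤ maximalIdeal S := by
    rw [hI, Ideal.span_le]
    rintro z (rfl | rfl)
    · exact ha
    · exact hb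
  obtain ⟨Q, hQmin, -⟩ := Ideal.exists_minimalPrimes_le hIm
  have hQprime : Q.IsPrime := hQmin.1.1
  have hIQ : I ≤ Q := hQmin.1.2
  refine ⟨Q, hQprime, hIQ (Ideal.subset_span (by simp)), hIQ (Ideal.subset_span (by simp)), ?_⟩
  intro hQm
  -- Krull: `height Q ≤ 2`
  have h1 := Ideal.height_le_spanRank_toENat_of_mem_minimalPrimes I _ hQmin
  have hfg : ((I.spanFinrank : ℕ) : ℕ∞) = I.spanRank.toENat := by
    rw [Submodule.fg_iff_spanRank_eq_spanFinrank.mpr (IsNoetherian.noetherian I), map_natCast]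
  have hcard : I.spanFinrank ≤ 2 := by
    refine (Submodule.spanFinrank_span_le_ncard_of_finite (Set.toFinite _)).trans ?_
    calc ({a, b} : Set S).ncard ≤ ({b} : Set S).ncard + 1 := Set.ncard_insert_le _ _
      _ = 2 := by rw [Set.ncard_singleton]
  have h2 : Q.height ≤ 2 := by
    refine h1.trans ?_
    rw [← hfg]
    exact_mod_cast hcard
  rw [hQm] at h2
  exact absurd hdim (not_lt.mpr h2)

/-- **The span clause in powers**: if `𝔪_{S₀}·S₁ = (x₀)` then every `y ∈ 𝔪_{S₀}^n` is `x₀^n · u` in `S₁`. [folklore] -/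
theorem exists_eq_pow_mul_of_mem_pow {L : Type} [Field L] {S₀ S₁ : Subring L} [IsLocalRing S₀] (h₀₁ : S₀ ≤ S₁) (x₀ : S₁)
    (hspan : Ideal.span ((fun y : S₀ => (⟨(y : L), h₀₁ y.2⟩ : S₁)) '' (maximalIdeal S₀ : Set S₀)) = Ideal.span {x₀})
    {n : ℕ} {y : S₀} (hy : y ∈ maximalIdeal S₀ ^ n) :
    ∃ u : S₁, (⟨(y : L), h₀₁ y.2⟩ : S₁) = x₀ ^ n * u := by
  have hmap : Ideal.map (Subring.inclusion h₀₁) (maximalIdeal S₀) = Ideal.span {x₀} := hspan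
  have hmem : Subring.inclusion h₀₁ y ∈ Ideal.map (Subring.inclusion h₀₁) (maximalIdeal S₀ ^ n) :=
    Ideal.mem_map_of_mem _ hy
  rw [Ideal.map_pow, hmap, Ideal.span_singleton_pow] at hmem
  obtain ⟨u, hu⟩ := Ideal.mem_span_singleton'.mp hmem
  exact ⟨u, by rw [mul_comm]; exact hu.symm⟩

/-! ## §2 The optimality conjunct of `CleanedOrderMonotone` -/

variable {L : Type} [Field L] (p : ℕ) [Fact p.Prime] [CharP L p]

/-- **Cleaning before an isolated next member is optimal** ((B1) of res-L0-w41-strat-2 §6⁗; the second conjunct of §σ2.26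
`CleanedOrderMonotone`, with `HasIsolatedSingularity (RadicandRing S₁ p f₁)` unfolded and the regular-parameter property of `x₀` as
binders). See the module docstring for the proof. [cite: Matsumura1987, Thm. 14.2, Thm. 19.4] [folklore] -/
theorem cleaning_optimal_of_isolated_next (S₀ S₁ : Subring L) [IsLocalRing S₀] [IsLocalRing S₁] (h₀₁ : S₀ ≤ S₁)
    (f₀ g₀ : S₀) (f₁ x₀ : S₁) (e₀ : ℕ) {c : ℕ} (hc : 2 < c)
    (hreg₁ : IsRegularLocalRing S₁) (hdim₁ : ringKrullDim S₁ = c)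
    (hx₀ : x₀ ∈ maximalIdeal S₁) (hx₀2 : x₀ ∉ maximalIdeal S₁ ^ 2)
    (hspan : Ideal.span ((fun y : S₀ => (⟨(y : L), h₀₁ y.2⟩ : S₁)) '' (maximalIdeal S₀ : Set S₀)) = Ideal.span {x₀})
    (hlaw : ((f₁ : S₁) : L) * ((x₀ : S₁) : L) ^ (p * e₀) = ((f₀ : S₀) : L) - ((g₀ : S₀) : L) ^ p)
    (hmult₁ : ∃ h : S₁, f₁ - h ^ p ∈ maximalIdeal S₁ ^ p)
    (hiso₁ : ∀ (P : Ideal (AdjoinRoot ((X : (S₁)[X]) ^ p - C f₁))) [P.IsPrime],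
      (∃ Q : Ideal (AdjoinRoot ((X : (S₁)[X]) ^ p - C f₁)), Q.IsPrime ∧ P < Q) →
      IsRegularLocalRing (Localization.AtPrime P)) :
    ∀ h : S₀, f₀ - h ^ p ∉ maximalIdeal S₀ ^ (p * e₀ + 1) := by
  intro h hh
  haveI := hreg₁
  have hp : p.Prime := Fact.out
  -- ### Step 1: `f₀ − h^p = x₀^(p e₀ + 1) · u` in `S₁`
  obtain ⟨u, hu⟩ := exists_eq_pow_mul_of_mem_pow h₀₁ x₀ hspan hh
  set F₀ : S₁ := ⟨(f₀ : L), h₀₁ f₀.2⟩ with hF₀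
  set G₀ : S₁ := ⟨(g₀ : L), h₀₁ g₀.2⟩ with hG₀
  set H : S₁ := ⟨(h : L), h₀₁ h.2⟩ with hH
  have hu' : F₀ - H ^ p = x₀ ^ (p * e₀ + 1) * u := by
    rw [← hu]
    exact Subtype.ext (by simp [hF₀, hH])
  -- the law in `S₁`
  have hlaw' : f₁ * x₀ ^ (p * e₀) = F₀ - G₀ ^ p :=
    Subtype.ext (by simpa [hF₀, hG₀] using hlaw)
  -- ### Step 2: `(H − G₀)^p = (x₀^{e₀})^p · (f₁ − x₀ u)`
  have hkey : (H - G₀) ^ p = (x₀ ^ e₀) ^ p * (f₁ - x₀ * u) := by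
    rw [sub_pow_char (R := S₁) H G₀]
    calc H ^ p - G₀ ^ p = (F₀ - G₀ ^ p) - (F₀ - H ^ p) := by ring
      _ = f₁ * x₀ ^ (p * e₀) - x₀ ^ (p * e₀ + 1) * u := by rw [hlaw', hu']
      _ = (x₀ ^ e₀) ^ p * (f₁ - x₀ * u) := by ring
  -- ### Step 3: normality — `x₀^{e₀} ∣ H − G₀`, `f₁ − q^p = x₀ u`
  haveI : IsIntegrallyClosed S₁ := isIntegrallyClosed_of_isRegularLocalRing S₁
  obtain ⟨q, hq⟩ := (IsIntegrallyClosed.pow_dvd_pow_iff hp.ne_zero).mp ⟨f₁ - x₀ * u, hkey⟩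
  have hx0' : x₀ ≠ 0 := fun h0 => hx₀2 (h0 ▸ Ideal.zero_mem _)
  have hf₁ : f₁ - q ^ p = x₀ * u := by
    have h1 : (x₀ ^ e₀) ^ p * (f₁ - x₀ * u) = (x₀ ^ e₀) ^ p * q ^ p := by rw [← hkey, hq, mul_pow]
    have hne : (x₀ ^ e₀) ^ p ≠ 0 := pow_ne_zero _ (pow_ne_zero _ hx0')
    have h2 := mul_left_cancel₀ hne h1
    linear_combination h2
  -- ### Step 4: the dichotomy on `u`
  by_cases hum : u ∈ maximalIdeal S₁
  · -- (ii) `u ∈ 𝔪₁`: a prime `Q ∌⊇ (x₀, u)`, `Q ≠ 𝔪₁` (Krull, `c ≥ 3`); the torsor is singular at `Q` — contradiction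
    have hheight : (2 : ℕ∞) < (maximalIdeal S₁).height := by
      have h3 : ((maximalIdeal S₁).height : WithBot ℕ∞) = (c : ℕ∞) := by
        rw [IsLocalRing.maximalIdeal_height_eq_ringKrullDim, hdim₁]; rfl
      have h4 : (maximalIdeal S₁).height = c := WithBot.coe_injective h3
      rw [h4]
      exact_mod_cast hc
    obtain ⟨Q, hQprime, hxQ, huQ, hQne⟩ := exists_prime_ne_maximalIdeal_of_two_lt_height hx₀ hum hheight
    haveI := hQprime
    have hsq : f₁ - q ^ p ∈ Q ^ 2 := by
      rw [hf₁, pow_two]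
      exact Ideal.mul_mem_mul hxQ huQ
    have hsing := AutoPermissible.not_isRegularLocalRing_atPrime_of_sub_pow_mem_sq (S := S₁) p f₁ Q hsq
    obtain ⟨P', hP', hunder, Q', hQ', hlt⟩ :=
      RadicandLocalization.exists_prime_under_eq_of_ne_maximalIdeal p f₁ Q hQne
    haveI := hP'
    have hregP' := hiso₁ P' ⟨Q', hQ', hlt⟩
    exact hsing ((RadicandLocalization.isRegularLocalRing_localization_atPrime_iff_of_under_eq p f₁ Q P' hunder).mp hregP')
  · -- (i) `u` a unit
    have huu : IsUnit u := by
      by_contra hnu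
      exact hum ((IsLocalRing.mem_maximalIdeal u).mpr hnu)
    obtain ⟨h₁, hh₁⟩ := hmult₁
    have hdec : f₁ - h₁ ^ p = x₀ * u + (q - h₁) ^ p := by
      rw [sub_pow_char (R := S₁) q h₁]
      linear_combination hf₁
    by_cases hqh : q - h₁ ∈ maximalIdeal S₁
    · -- `x₀ u ∈ 𝔪₁^p`, so `x₀ ∈ 𝔪₁^p ⊆ 𝔪₁²`
      have h1 : x₀ * u ∈ maximalIdeal S₁ ^ p := by
        have := Ideal.sub_mem _ hh₁ (Ideal.pow_mem_pow hqh p)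
        rwa [hdec, add_sub_cancel_right] at this
      have h2 : x₀ ∈ maximalIdeal S₁ ^ p := by
        obtain ⟨v, hv⟩ := huu
        have h3 := Ideal.mul_mem_right (↑v⁻¹ : S₁) _ h1
        rwa [mul_assoc, ← hv, Units.mul_inv, mul_one] at h3
      exact hx₀2 (Ideal.pow_le_pow_right hp.two_le h2)
    · -- `q − h₁` a unit: `f₁ − h₁^p` is a unit, yet lies in `𝔪₁^p ⊆ 𝔪₁`
      have hqu : IsUnit (q - h₁) := by
        by_contra hnu
        exact hqh ((IsLocalRing.mem_maximalIdeal _).mpr hnu)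
      have hmem : x₀ * u ∈ maximalIdeal S₁ := Ideal.mul_mem_right _ _ hx₀
      have hin : f₁ - h₁ ^ p ∈ maximalIdeal S₁ := Ideal.pow_le_self hp.ne_zero hh₁
      rw [hdec] at hin
      have hpu : (q - h₁) ^ p ∈ maximalIdeal S₁ := by
        have := Ideal.sub_mem _ hin hmem
        rwa [add_sub_cancel_left] at this
      exact (IsLocalRing.mem_maximalIdeal _).mp hpu (hqu.pow p)

/-! ## §3 The binders `x₀ ∈ 𝔪_{S₁} ∖ 𝔪_{S₁}²` from the K♭ step data -/

omit [Fact p.Prime] [CharP L p] in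
/-- **The exceptional parameter of a quadratic transform between regular local rings is a regular parameter of the target.**
For a quadratic transform `S₀ → S₁` (Cutkosky §2.1) of REGULAR local subrings of `L` and any `x₀` with `𝔪_{S₀}·S₁ = (x₀)`:
`x₀ ∈ 𝔪_{S₁} ∖ 𝔪_{S₁}²`. Route: a valuation ring `W` dominating `S₁` (Chevalley) makes the transform the local blowing up along
`W` (`IsQuadraticTransform.along`), so `S₁ = (S₀[𝔪₀/x])_{𝔪_W ∩ S₀[𝔪₀/x]}` for a least-value `x ∈ 𝔪₀`
(`IsQuadraticTransformAlong.exists_eq_locAtCentre`), `x ∉ 𝔪₀²` (`QuadraticStep.not_mem_sq_of_forall_valuation_le`), the exceptional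
hypersurface `S₀[𝔪₀/x]/(x)` is a regular ring and so is its localisation `S₁/(x)` (`DivisorTrigger.isRegularRing_blowupRing_quotient`,
`…isRegularLocalRing_locAtCentre_quotient`), whence `x ∉ 𝔪₁²` (`HighPointStep.not_mem_sq_of_isRegularLocalRing_quotient`,
Matsumura 14.2); finally `x₀` and `x` are associates in `S₁`. [cite: Cutkosky2014, §2.1–2.2] [cite: Matsumura1987, Thm. 14.2] -/
theorem excParam_mem_and_not_mem_sq {S₀ S₁ : Subring L} [IsLocalRing S₀] [IsLocalRing S₁]
    (hreg₀ : IsRegularLocalRing S₀) (hreg₁ : IsRegularLocalRing S₁)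
    (hQT : IsQuadraticTransform S₀ S₁) (h₀₁ : S₀ ≤ S₁) (x₀ : S₁)
    (hspan : Ideal.span ((fun y : S₀ => (⟨(y : L), h₀₁ y.2⟩ : S₁)) '' (maximalIdeal S₀ : Set S₀)) = Ideal.span {x₀}) :
    x₀ ∈ maximalIdeal S₁ ∧ x₀ ∉ maximalIdeal S₁ ^ 2 := by
  classical
  haveI := hreg₀
  haveI := hreg₁
  -- ### a valuation ring dominating `S₁`; the transform is the local blowing up along it
  obtain ⟨W, hW⟩ := (LocalSubring.mk S₁).exists_le_valuationSubring
  haveI : IsLocalRing W.toSubring := inferInstanceAs (IsLocalRing W)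
  have hSW : SubringDominates S₁ W.toSubring := (subringDominates_iff S₁ W.toSubring).mpr hW
  have hdom : SubringDominates S₀ S₁ := hQT.dominates
  have hdom₀ : SubringDominates S₀ W.toSubring := hdom.trans hSW
  have hA : IsQuadraticTransformAlong W S₀ S₁ := hQT.along ⟨inferInstance, IsNoetherian.noetherian _⟩ hSW
  obtain ⟨_, x, hxm, hx0, hmax, hS₁⟩ := hA.exists_eq_locAtCentre
  have hx0K : (x : L) ≠ 0 := fun h => hx0 (Subtype.ext h)
  have hx2 : x ∉ maximalIdeal S₀ ^ 2 := QuadraticStep.not_mem_sq_of_forall_valuation_le hdom₀ hx0K hmax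
  -- ### domination: `𝔪₀ ⊆ 𝔪₁`
  have hmm : ∀ y : S₀, y ∈ maximalIdeal S₀ → (⟨(y : L), h₀₁ y.2⟩ : S₁) ∈ maximalIdeal S₁ := by
    intro y hy
    by_contra hy1
    have hu1 : IsUnit (⟨(y : L), h₀₁ y.2⟩ : S₁) := by
      by_contra hnu
      exact hy1 ((IsLocalRing.mem_maximalIdeal _).mpr hnu)
    obtain ⟨hy0, hinv⟩ := (isUnit_subring_iff_inv_mem _).mp hu1
    have hinv₀ : ((y : L))⁻¹ ∈ S₀ := hdom.2 (y : L) y.2 hinv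
    have hu0 : IsUnit y := (isUnit_subring_iff_inv_mem y).mpr ⟨hy0, hinv₀⟩
    exact (IsLocalRing.mem_maximalIdeal _).mp hy hu0
  -- ### `x` as an element of `S₁`: a regular parameter
  have hxS₁ : (x : L) ∈ S₁ := h₀₁ x.2
  set X : S₁ := ⟨(x : L), hxS₁⟩ with hXdef
  have hXm : X ∈ maximalIdeal S₁ := hmm x hxm
  have hX0 : X ≠ 0 := fun h => hx0K (congrArg Subtype.val h)
  have hregX : IsRegularLocalRing (S₁ ⧸ Ideal.span {X}) := by
    have hxm' : (⟨(x : L), x.2⟩ : S₀) ∈ maximalIdeal S₀ := by simpa using hxm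
    have hx2' : (⟨(x : L), x.2⟩ : S₀) ∉ maximalIdeal S₀ ^ 2 := by simpa using hx2
    haveI hC := DivisorTrigger.isRegularRing_blowupRing_quotient S₀ (x := (x : L)) x.2 hxm' hx2' hx0K
    have hCO : blowupRing S₀ (x : L) ≤ W.toSubring :=
      (le_locAtCentre _ W).trans (le_of_eq_of_le hS₁.symm hSW.1)
    have hvx : W.valuation (x : L) < 1 := ((subringDominates_valuationSubring_iff hdom₀.1).mp hdom₀ x).mp hxm
    have h := DivisorTrigger.isRegularLocalRing_locAtCentre_quotient hCO ⟨(x : L), le_blowupRing S₀ (x : L) x.2⟩ hvx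
    have key : ∀ (T : Subring L) (_ : T = locAtCentre (blowupRing S₀ (x : L)) W) (hxT : (x : L) ∈ T),
        IsRegularLocalRing (T ⧸ Ideal.span {(⟨(x : L), hxT⟩ : T)}) := by
      intro T hT hxT
      subst hT
      exact h
    exact key S₁ hS₁ hxS₁
  have hX2 : X ∉ maximalIdeal S₁ ^ 2 := HighPointStep.not_mem_sq_of_isRegularLocalRing_quotient hXm hX0 hregX
  -- ### `x₀` and `X` are associates in `S₁`
  have hXx₀ : X ∈ Ideal.span {x₀} := by
    rw [← hspan]
    exact Ideal.subset_span ⟨x, hxm, rfl⟩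
  obtain ⟨a, ha⟩ := Ideal.mem_span_singleton'.mp hXx₀
  -- `x₀ ∈ X · S₁`
  have hBS : blowupRing S₀ (x : L) ≤ S₁ := by
    rw [hS₁]
    exact le_locAtCentre _ W
  have hx₀X : x₀ ∈ Ideal.span {X} := by
    have hle : Ideal.span ((fun y : S₀ => (⟨(y : L), h₀₁ y.2⟩ : S₁)) '' (maximalIdeal S₀ : Set S₀)) ≤ Ideal.span {X} := by
      rw [Ideal.span_le]
      rintro _ ⟨y, hy, rfl⟩
      refine Ideal.mem_span_singleton'.mpr ⟨⟨(y : L) / x, hBS (div_mem_blowupRing (x : L) hy)⟩, ?_⟩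
      exact Subtype.ext (by
        change (y : L) / x * x = y
        rw [div_mul_cancel₀ _ hx0K])
    rw [hspan] at hle
    exact hle (Ideal.mem_span_singleton_self x₀)
  obtain ⟨b, hb⟩ := Ideal.mem_span_singleton'.mp hx₀X
  refine ⟨?_, ?_⟩
  · -- `x₀ = b X ∈ 𝔪₁`
    rw [← hb]
    exact Ideal.mul_mem_left _ b hXm
  · intro hx₀2
    apply hX2
    rw [← ha]
    exact Ideal.mul_mem_left _ a hx₀2

/-! ## §4 The optimality conjunct over the K♭ step binders verbatim -/

/-- **Optimality conjunct of `CleanedOrderMonotone`, K♭ binders verbatim** (`IsQuadraticTransform S₀ S₁` + the span clause supply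
`x₀ ∈ 𝔪_{S₁} ∖ 𝔪_{S₁}²` by §3): along one K♭ step in codimension `c ≥ 3` with multiplicity `p` and isolated torsor singularity at stage 1,
`∀ h : S₀, f₀ − h^p ∉ 𝔪_{S₀}^(p·e₀ + 1)`. [cite: Matsumura1987, Thm. 14.2, Thm. 19.4] [cite: Cutkosky2014, §2.1] [folklore] -/
theorem cleaning_optimal_of_quadraticTransform (S₀ S₁ : Subring L) [IsLocalRing S₀] [IsLocalRing S₁] (h₀₁ : S₀ ≤ S₁)
    (f₀ g₀ : S₀) (f₁ x₀ : S₁) (e₀ : ℕ) {c : ℕ} (hc : 2 < c)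
    (hreg₀ : IsRegularLocalRing S₀) (hreg₁ : IsRegularLocalRing S₁) (hdim₁ : ringKrullDim S₁ = c)
    (hQT : IsQuadraticTransform S₀ S₁)
    (hspan : Ideal.span ((fun y : S₀ => (⟨(y : L), h₀₁ y.2⟩ : S₁)) '' (maximalIdeal S₀ : Set S₀)) = Ideal.span {x₀})
    (hlaw : ((f₁ : S₁) : L) * ((x₀ : S₁) : L) ^ (p * e₀) = ((f₀ : S₀) : L) - ((g₀ : S₀) : L) ^ p)
    (hmult₁ : ∃ h : S₁, f₁ - h ^ p ∈ maximalIdeal S₁ ^ p)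
    (hiso₁ : ∀ (P : Ideal (AdjoinRoot ((X : (S₁)[X]) ^ p - C f₁))) [P.IsPrime],
      (∃ Q : Ideal (AdjoinRoot ((X : (S₁)[X]) ^ p - C f₁)), Q.IsPrime ∧ P < Q) →
      IsRegularLocalRing (Localization.AtPrime P)) :
    ∀ h : S₀, f₀ - h ^ p ∉ maximalIdeal S₀ ^ (p * e₀ + 1) :=
  have hx := excParam_mem_and_not_mem_sq hreg₀ hreg₁ hQT h₀₁ x₀ hspan
  cleaning_optimal_of_isolated_next p S₀ S₁ h₀₁ f₀ g₀ f₁ x₀ e₀ hc hreg₁ hdim₁ hx.1 hx.2 hspan hlaw hmult₁ hiso₁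

end Summit.ResolutionOfSingularities.ResolutionOfSingularities.Theorems.SwitchingDichotomy.CleaningOptimal

end
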